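import Summits.AnomalousDissipation.AnomalousDissipation.Theorems.FloorCertificate.Negative.WeakDuality
import Summits.AnomalousDissipation.AnomalousDissipation.Theorems.FloorCertificate.Negative.UniformTools

/-!
# `TaylorCertificates.FloorCertificate` (stmt-AnomalousDissipation-14091) — negative side II:
# no ν-INDEPENDENT floor certificate exists, for any force

The natural strengthening `FloorCertificateUniform` of the crux (quantifier swap: ONE cylindrical
multiplier `Φ₁` and ONE weight `θ₁ ≤ 0`, chosen after `f` but before `ν`, serving every `ν < ν₀`) is
FALSE for EVERY force: `not_floorCertificateUniform` (cdisprove seat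
`refuter-cdisprove-stmt-AnomalousDissipation-14091-0`, 2026-08-16; 0 sorry).

Witness (frozen-multiplier beat). The floor at rest gives `(f, w₀) ≥ ε₀ > 0` for `w₀ := Φ₁'(0)`, so `w₀`
has a Fourier mode `q ≠ 0` with `ŵ₀(q) ≠ 0`; `frame_selection` gives an integer direction `r ⊥ q` and a
real unit `B ⊥ r, q` with `ζ := ⟪ŵ₀(q), B⟫ ≠ 0`. The states `u_t = Re(e_{(t+1)r} zA) + Re(e_{(t+1)r+q} zB)`
(`zA = (A/|q|) q`, `zB = ω A B`, `ω = −i ζ̄/|ζ|`) lie in `H`, have finite enstrophy, and as `t → ∞`: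
their cylindrical coordinates tend to `0` (Riemann–Lebesgue for the smooth test fields), hence
`Φ₁'(u_t) → w₀` coefficientwise (`φ ∈ C¹`); the forcing term tends to `(f, w₀)`, the energy input
`(u_t, f) → 0`, and the inertial term (pair formula, `inertial_two` of `UniformTools.lean`) tends to the BEAT
`−π A² |q| |ζ|` (the self-sum tail at `2(t+1)r + q` dies by Riemann–Lebesgue). With
`A = 1 + ((f,w₀) + 2)/(π|ζ|)` the inviscid part of the floor is eventually `< −1`; fixing such a `t`
and then `ν` small (the Leray ball grows like `ν⁻²`, the viscous terms are `O(ν)`), the FLOOR at `u_t`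
reads `ε₀ ≤ (< 0)`. MORAL: any witness of `FloorCertificate` must let its multiplier or its weight
degenerate as `ν → 0` (cf. `floor_at_quiet_euler_point` in `WeakDuality.lean`).
-/

noncomputable section

set_option linter.dupNamespace false

open MeasureTheory UnitAddTorus Matrix Filter Topology
open scoped InnerProductSpace ENNReal ComplexConjugate

namespace Summit.AnomalousDissipation.AnomalousDissipation.Theorems.FloorCertificate.Negative

open Literature.Analysis.FunctionSpaces Literature.Analysis.FluidPDE
open Summit.AnomalousDissipation.AnomalousDissipation.Theses.TaylorCertificates
open Summit.AnomalousDissipation.AnomalousDissipation.Theorems.TaylorCertificatePair.Negative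

/-! ## §E The ν-INDEPENDENT strengthening is false for every force

Natural first ansatz of a prover: ONE certificate `(Φ₁, θ₁)` (chosen after `f`, before `ν`) serving all
small `ν`. It is refuted below for EVERY force by a frozen-multiplier beat: two plane waves at
`p = t r` and `p + q` escaping to infinity (`t → ∞`) are asymptotically invisible to the finitely many
test fields (Riemann–Lebesgue), so `Φ₁'(u_t) → Φ₁'(0) =: w₀`, while their inertial pairing against `w₀`
converges to the BEAT `−π A² |q| |ζ|` at a Fourier mode `q` of `w₀` (`ζ ≠ 0` exists because
`(f, w₀) ≥ ε₀ > 0` forces `w₀ ≠ 0`); the amplitude `A` is free (the Leray ball grows like `ν⁻²`), so the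
inviscid part of the FLOOR tends to `(f, w₀) − πA²|q||ζ| ≤ −2`, and `ν` chosen last makes the viscous
terms negligible. MORAL for provers: the certificate MUST sharpen with `ν` (its resolution or its weight
must blow up as `ν → 0`; cf. §D). -/

/-- NATURAL STRENGTHENING of the crux (quantifier swap `∃ Φ₁ θ₁, ∀ ν` instead of `∀ ν, ∃ Φ₁ θ₁`):
ONE cylindrical multiplier and ONE weight serve every `ν ∈ (0, ν₀)`. FALSE for every force
(`not_floorCertificateUniform`). -/
def FloorCertificateUniform : Prop :=
  ∃ f : (UnitAddTorus (Fin 3) → EuclideanSpace ℝ (Fin 3)), Torus.IsSmooth f ∧ Torus.IsDivFree f ∧ Torus.HasZeroMean f ∧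
    ∃ (ε₀ ν₀ : ℝ) (Φ₁ : Torus.CylindricalTest (Fin 3)) (θ₁ : ℝ), 0 < ε₀ ∧ 0 < ν₀ ∧ θ₁ ≤ 0 ∧
      ∀ ν : ℝ, 0 < ν → ν < ν₀ → ∀ u : (Torus.energySpace (Fin 3)), FloorIneq ν f Φ₁ θ₁ ε₀ u

/-! ### §E.5 The refutation of the uniform certificate -/

set_option maxHeartbeats 800000 in
/-- **No ν-independent floor certificate exists, for any force** (refutation of the natural
strengthening `FloorCertificateUniform`; witness: two escaping plane waves beating at a Fourier mode of
`Φ₁'(0)` — see the head of §E). Consequently any witness of `FloorCertificate` must let `Φ₁` or `θ₁`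
degenerate as `ν → 0`. -/
theorem not_floorCertificateUniform : ¬ FloorCertificateUniform := by
  rintro ⟨f, hfs, -, -, ε₀, ν₀, Φ, θ, hε₀, hν₀, hθ, hcert⟩
  have hfi : Integrable f volume := hfs.integrable
  /- Step 1: the multiplier pushes at rest, the force is nonzero. -/
  have hν₀2 : 0 < ν₀ / 2 := half_pos hν₀
  have hrest : ε₀ ≤ ∫ x, ⟪f x, Φ.grad 0 x⟫_ℝ := floor_at_rest hν₀2 (hcert (ν₀ / 2) hν₀2 (by linarith) 0)
  have hF2 : 0 < ∫ x, ‖f x‖ ^ 2 :=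
    floorFamily_force_ne_zero hfs hε₀ hν₀2 ⟨Φ, θ, hθ, hcert (ν₀ / 2) hν₀2 (by linarith)⟩
  set M : ℝ := ∫ x, ⟪f x, Φ.grad 0 x⟫_ℝ with hM
  have hM0 : 0 < M := hε₀.trans_le hrest
  /- Step 2: a nonzero mode `q` of `w₀ = Φ'(0)`, the frame `(r, B)` and `ζ ≠ 0`. -/
  obtain ⟨q, hq, hgq⟩ := exists_fc_grad_zero_ne_zero Φ hM0
  set g : EuclideanSpace ℂ (Fin 3) := mFourierCoeff (EuclideanSpace.complexify ∘ Φ.grad (0 : (Torus.energySpace (Fin 3)))) q with hgdef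
  have hgt : ((fun j => ((q) j : ℂ)) ⬝ᵥ (WithLp.ofLp (g))) = 0 := dotc_fc_grad Φ 0 q
  obtain ⟨r, B, hr, hrq, -, hB1, hrB, hqB, hgB⟩ := frame_selection hq g hgt
  set ζ : ℂ := ⟪g, EuclideanSpace.complexify B⟫_ℂ with hζdef
  have hζ0 : ζ ≠ 0 := by
    intro h0
    rw [h0, norm_zero] at hgB
    have hg0 : ‖g‖ = 0 := by nlinarith [norm_nonneg g]
    exact hgq (norm_eq_zero.1 hg0)
  have hζn : 0 < ‖ζ‖ := norm_pos_iff.2 hζ0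
  have hsq1 : 1 ≤ Real.sqrt (Torus.freqNormSq q) := by
    rw [show (1 : ℝ) = Real.sqrt 1 from Real.sqrt_one.symm]
    exact Real.sqrt_le_sqrt (Torus.one_le_freqNormSq_of_ne_zero hq)
  /- Step 3: the amplitude `A` with `π A² |q| |ζ| ≥ M + 2`. -/
  set A : ℝ := 1 + (M + 2) / (Real.pi * ‖ζ‖) with hAdef
  have hπζ : 0 < Real.pi * ‖ζ‖ := mul_pos Real.pi_pos hζn
  have hA1 : 1 ≤ A := by
    rw [hAdef]
    have : 0 ≤ (M + 2) / (Real.pi * ‖ζ‖) := div_nonneg (by linarith) hπζ.le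
    linarith
  have hA0 : 0 < A := by linarith
  have hgain : M + 2 ≤ Real.pi * A * A * Real.sqrt (Torus.freqNormSq q) * ‖ζ‖ := by
    have h1 : Real.pi * ‖ζ‖ * A = Real.pi * ‖ζ‖ + (M + 2) := by
      rw [hAdef, mul_add, mul_one, mul_div_cancel₀ _ hπζ.ne']
    have hX : 0 ≤ Real.pi * ‖ζ‖ * A := by positivity
    have h2a : Real.pi * ‖ζ‖ * A ≤ Real.pi * ‖ζ‖ * A * A := by
      nlinarith [mul_nonneg hX (sub_nonneg.2 hA1)]
    have h2b : Real.pi * ‖ζ‖ * A * A ≤ Real.pi * ‖ζ‖ * A * A * Real.sqrt (Torus.freqNormSq q) := by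
      nlinarith [mul_nonneg (mul_nonneg hX hA0.le) (sub_nonneg.2 hsq1)]
    have h3 : Real.pi * ‖ζ‖ * A * A * Real.sqrt (Torus.freqNormSq q) =
        Real.pi * A * A * Real.sqrt (Torus.freqNormSq q) * ‖ζ‖ := by ring
    linarith
  /- The polarisations. -/
  set zA : EuclideanSpace ℂ (Fin 3) :=
    ((((A) / Real.sqrt (Torus.freqNormSq (q)) : ℝ) : ℂ) • EuclideanSpace.complexify (WithLp.toLp 2 (fun i => ((q) i : ℝ)))) with hzAdef
  set zB : EuclideanSpace ℂ (Fin 3) :=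
    ((((-Complex.I * conj ((ζ)) * ((‖(ζ)‖⁻¹ : ℝ) : ℂ)) * ((A) : ℂ)) • EuclideanSpace.complexify (B))) with hzBdef
  have hzA : ‖zA‖ = A := norm_polA hA0.le hq
  have hzB : ‖zB‖ = A := norm_polB A hA0.le hζ0 hB1
  have hqzB : ((fun j => ((q) j : ℂ)) ⬝ᵥ (WithLp.ofLp (zB))) = 0 := by
    rw [hzBdef, dotc_polB, hqB]; simp
  /- Step 4: the ray of states `u t` with representative `U t = Re(e_{P t} zA) + Re(e_{P t + q} zB)`. -/
  set P : ℕ → (Fin 3 → ℤ) := fun t => (fun i => (t : ℤ) * r i) + r with hPdef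
  have hPzA : ∀ t, ((fun j => ((P t) j : ℂ)) ⬝ᵥ (WithLp.ofLp (zA))) = 0 := fun t => by
    rw [hzAdef, dotc_polA, show P t ⬝ᵥ q = 0 from ray_dot hrq t]; simp
  have hPzB : ∀ t, ((fun j => ((P t) j : ℂ)) ⬝ᵥ (WithLp.ofLp (zB))) = 0 := fun t => by
    rw [hzBdef, dotc_polB, show (∑ j, ((P t j : ℝ)) * B j) = 0 from ray_sum_mul B hrB t]; simp
  have hPqzB : ∀ t, ((fun j => (((P t + q)) j : ℂ)) ⬝ᵥ (WithLp.ofLp (zB))) = 0 := fun t => by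
    rw [hzBdef, dotc_polB, show (∑ j, (((P t + q) j : ℝ)) * B j) = 0 from ray_add_sum_mul B hrB hqB t]; simp
  have hk : ∀ t, ∀ m, (![P t, P t + q] : Fin 2 → (Fin 3 → ℤ)) m ≠ 0 := fun t =>
    Fin.forall_fin_two.2 ⟨ray_ne_zero hr t, ray_add_ne_zero hq hrq t⟩
  have hz : ∀ t, ∀ m, ((fun j => (((![P t, P t + q] : Fin 2 → (Fin 3 → ℤ)) m) j : ℂ)) ⬝ᵥ
      (WithLp.ofLp ((![zA, zB] : Fin 2 → EuclideanSpace ℂ (Fin 3)) m))) = 0 := fun t =>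
    Fin.forall_fin_two.2 ⟨hPzA t, hPqzB t⟩
  choose u hu using fun t => exists_state (![P t, P t + q]) (![zA, zB]) (hk t) (hz t)
  /- Step 5: limits along the ray. Coefficients `cᵢ(t) = ∂ᵢφ(coords(u t))`. -/
  set c : Fin Φ.m → ℕ → ℝ := fun i t => _root_.fderiv ℝ Φ.φ (Φ.coords (u t)) (EuclideanSpace.single i 1) with hcdef
  set cinf : Fin Φ.m → ℝ := fun i => _root_.fderiv ℝ Φ.φ 0 (EuclideanSpace.single i 1) with hcinfdef
  -- (L1) coordinates tend to zero
  have hL1 : ∀ i, Tendsto (fun t => Torus.pairing (((u t : (Torus.energySpace (Fin 3)))) : (Lp (EuclideanSpace ℝ (Fin 3)) 2 (volume : Measure (UnitAddTorus (Fin 3))))) (Φ.g i)) atTop (𝓝 0) := by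
    intro i
    have h : ∀ t, Torus.pairing (((u t : (Torus.energySpace (Fin 3)))) : (Lp (EuclideanSpace ℝ (Fin 3)) 2 (volume : Measure (UnitAddTorus (Fin 3))))) (Φ.g i) =
        (⟪zA, mFourierCoeff (EuclideanSpace.complexify ∘ Φ.g i) ((fun j => (t : ℤ) * r j) + r)⟫_ℂ).re +
        (⟪zB, mFourierCoeff (EuclideanSpace.complexify ∘ Φ.g i) ((fun j => (t : ℤ) * r j) + (r + q))⟫_ℂ).re := by
      intro t
      rw [pairing_of_ae (hu t), integral_inner_modes_left (Φ.g_smooth i).integrable, Fin.sum_univ_two]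
      simp only [Matrix.cons_val_zero, Matrix.cons_val_one]
      rw [← ray_add_eq t]
    simp_rw [h]
    simpa using (tendsto_re_inner_fc_ray (Φ.g_smooth i) hr r zA).add
      (tendsto_re_inner_fc_ray (Φ.g_smooth i) hr (r + q) zB)
  have hcoords : Tendsto (fun t => Φ.coords (u t)) atTop (𝓝 0) := by
    have hv : Tendsto (fun t => fun i => Torus.pairing (((u t : (Torus.energySpace (Fin 3)))) : (Lp (EuclideanSpace ℝ (Fin 3)) 2 (volume : Measure (UnitAddTorus (Fin 3))))) (Φ.g i)) atTop (𝓝 0) :=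
      tendsto_pi_nhds.2 fun i => hL1 i
    have h := ((PiLp.continuous_toLp 2 (fun _ : Fin Φ.m => ℝ)).tendsto 0).comp hv
    rw [WithLp.toLp_zero] at h
    exact h
  -- (L3) the coefficients converge
  have hL3 : ∀ i, Tendsto (c i) atTop (𝓝 (cinf i)) := by
    intro i
    have hcont : Continuous fun x : EuclideanSpace ℝ (Fin Φ.m) => _root_.fderiv ℝ Φ.φ x (EuclideanSpace.single i 1) :=
      (Φ.φ_contDiff.continuous_fderiv one_ne_zero).clm_apply continuous_const
    exact (hcont.tendsto 0).comp hcoords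
  -- (L4) the forcing term `(f, Φ'(u t)) → M`
  have hL4 : Tendsto (fun t => ∫ x, ⟪f x, Φ.grad (u t) x⟫_ℝ) atTop (𝓝 M) := by
    have h1 : ∀ t, (∫ x, ⟪f x, Φ.grad (u t) x⟫_ℝ) = ∑ i, c i t * ∫ x, ⟪f x, Φ.g i x⟫_ℝ := fun t =>
      integral_inner_grad_right Φ hfi (u t)
    have h2 : M = ∑ i, cinf i * ∫ x, ⟪f x, Φ.g i x⟫_ℝ := by
      rw [hM, integral_inner_grad_right Φ hfi 0, coords_zero]
    simp_rw [h1]; rw [h2]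
    exact tendsto_finsetSum _ fun i _ => (hL3 i).mul_const _
  -- (L5) the resolved coefficient at the beat frequency converges to `g`, hence the beat converges
  have hL5 : Tendsto (fun t => mFourierCoeff (EuclideanSpace.complexify ∘ Φ.grad (u t)) q) atTop (𝓝 g) := by
    have h1 : ∀ t, mFourierCoeff (EuclideanSpace.complexify ∘ Φ.grad (u t)) q =
        ∑ i, ((c i t : ℝ) : ℂ) • mFourierCoeff (EuclideanSpace.complexify ∘ Φ.g i) q := fun t => fc_grad_eq_sum Φ (u t) q
    have h2 : g = ∑ i, ((cinf i : ℝ) : ℂ) • mFourierCoeff (EuclideanSpace.complexify ∘ Φ.g i) q := by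
      rw [hgdef, fc_grad_eq_sum Φ 0 q, coords_zero]
    simp_rw [h1]; rw [h2]
    exact tendsto_finsetSum _ fun i _ => ((Complex.continuous_ofReal.tendsto _).comp (hL3 i)).smul_const _
  have hbeat : Tendsto (fun t => Real.pi * (conj (((fun j => ((q) j : ℂ)) ⬝ᵥ (WithLp.ofLp (zA)))) *
      ⟪mFourierCoeff (EuclideanSpace.complexify ∘ Φ.grad (u t)) q, zB⟫_ℂ).im) atTop
      (𝓝 (-(Real.pi * A * A * Real.sqrt (Torus.freqNormSq q) * ‖ζ‖))) := by
    have h := beat_value g hq A A B hζ0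
    rw [← h]
    exact ((Complex.continuous_im.tendsto _).comp ((hL5.inner tendsto_const_nhds).const_mul _)).const_mul _
  -- (L6) the self-sum tail tends to zero
  have hL6 : Tendsto (fun t => Real.pi * ((((fun j => ((q) j : ℂ)) ⬝ᵥ (WithLp.ofLp (zA)))) *
      ⟪mFourierCoeff (EuclideanSpace.complexify ∘ Φ.grad (u t)) (P t + (P t + q)), zB⟫_ℂ).im) atTop (𝓝 0) := by
    have hb : Tendsto (fun t => ∑ i, |c i t| *
        ‖mFourierCoeff (EuclideanSpace.complexify ∘ Φ.g i) ((fun j => (t : ℤ) * (r + r) j) + (r + r + q))‖) atTop (𝓝 0) := by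
      have : Tendsto (fun t => ∑ i, |c i t| *
          ‖mFourierCoeff (EuclideanSpace.complexify ∘ Φ.g i) ((fun j => (t : ℤ) * (r + r) j) + (r + r + q))‖) atTop
          (𝓝 (∑ i, |cinf i| * 0)) :=
        tendsto_finsetSum _ fun i _ => (hL3 i).abs.mul (tendsto_fc_ray (Φ.g_smooth i) (two_ray_ne_zero hr) (r + r + q))
      simpa using this
    refine squeeze_zero_norm (fun t => ?_) (by simpa using hb.const_mul (Real.pi * ‖(((fun j => ((q) j : ℂ)) ⬝ᵥ (WithLp.ofLp (zA))))‖ * ‖zB‖))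
    refine (norm_pi_mul_im_le _ _ _).trans ?_
    refine mul_le_mul_of_nonneg_left ?_ (by positivity)
    rw [show P t + (P t + q) = (fun j => (t : ℤ) * (r + r) j) + (r + r + q) from ray_self_sum t]
    exact norm_fc_grad_le Φ (u t) _
  -- (L7) the energy input `(u t, f) → 0`
  have hL7 : Tendsto (fun t => ∫ x, ⟪(∑ mm, Torus.realTrigPoly {(![P t, P t + q] : Fin 2 → (Fin 3 → ℤ)) mm}
      (fun _ => (![zA, zB] : Fin 2 → EuclideanSpace ℂ (Fin 3)) mm)) x, f x⟫_ℝ) atTop (𝓝 0) := by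
    have h : ∀ t, (∫ x, ⟪(∑ mm, Torus.realTrigPoly {(![P t, P t + q] : Fin 2 → (Fin 3 → ℤ)) mm}
        (fun _ => (![zA, zB] : Fin 2 → EuclideanSpace ℂ (Fin 3)) mm)) x, f x⟫_ℝ) =
        (⟪zA, mFourierCoeff (EuclideanSpace.complexify ∘ f) ((fun j => (t : ℤ) * r j) + r)⟫_ℂ).re +
        (⟪zB, mFourierCoeff (EuclideanSpace.complexify ∘ f) ((fun j => (t : ℤ) * r j) + (r + q))⟫_ℂ).re := by
      intro t
      rw [integral_inner_modes_left hfi, Fin.sum_univ_two]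
      simp only [Matrix.cons_val_zero, Matrix.cons_val_one]
      rw [← ray_add_eq t]
    simp_rw [h]
    simpa using (tendsto_re_inner_fc_ray hfs hr r zA).add (tendsto_re_inner_fc_ray hfs hr (r + q) zB)
  /- The inviscid part of the floor and its limit `≤ -2`. -/
  have hΩ : Tendsto (fun t => (∫ x, ⟪f x, Φ.grad (u t) x⟫_ℝ) +
      (Real.pi * ((((fun j => ((q) j : ℂ)) ⬝ᵥ (WithLp.ofLp (zA)))) *
          ⟪mFourierCoeff (EuclideanSpace.complexify ∘ Φ.grad (u t)) (P t + (P t + q)), zB⟫_ℂ).im +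
        Real.pi * (conj (((fun j => ((q) j : ℂ)) ⬝ᵥ (WithLp.ofLp (zA)))) *
          ⟪mFourierCoeff (EuclideanSpace.complexify ∘ Φ.grad (u t)) q, zB⟫_ℂ).im) +
      2 * θ * ∫ x, ⟪(∑ mm, Torus.realTrigPoly {(![P t, P t + q] : Fin 2 → (Fin 3 → ℤ)) mm}
        (fun _ => (![zA, zB] : Fin 2 → EuclideanSpace ℂ (Fin 3)) mm)) x, f x⟫_ℝ) atTop
      (𝓝 (M + (0 + -(Real.pi * A * A * Real.sqrt (Torus.freqNormSq q) * ‖ζ‖)) + 2 * θ * 0)) :=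
    (hL4.add (hL6.add hbeat)).add (hL7.const_mul _)
  have hlim : M + (0 + -(Real.pi * A * A * Real.sqrt (Torus.freqNormSq q) * ‖ζ‖)) + 2 * θ * 0 < -1 := by
    linarith
  obtain ⟨t, ht⟩ := (hΩ.eventually (gt_mem_nhds hlim)).exists
  /- Step 6: the floor at `u t` for a small viscosity. -/
  have huU := hu t
  have hGs : Torus.IsSmooth (Φ.grad (u t)) := isSmooth_grad Φ (u t)
  have hfin : Torus.eGradNormSq (((u t : (Torus.energySpace (Fin 3))) : (Lp (EuclideanSpace ℝ (Fin 3)) 2 (volume : Measure (UnitAddTorus (Fin 3))))) : (UnitAddTorus (Fin 3) → EuclideanSpace ℝ (Fin 3))) ≠ ⊤ := by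
    rw [eGradNormSq_congr_ae' huU]; exact eGradNormSq_modes_ne_top
  have hnormsq : ‖u t‖ ^ 2 ≤ 4 * A ^ 2 := by
    rw [norm_sq_of_ae huU]
    refine (integral_norm_sq_modes_le).trans ?_
    have : (∑ m, ‖(![zA, zB] : Fin 2 → EuclideanSpace ℂ (Fin 3)) m‖) = 2 * A := by
      rw [Fin.sum_univ_two]
      change ‖zA‖ + ‖zB‖ = 2 * A
      rw [hzA, hzB]; ring
    rw [this]; nlinarith
  -- the viscosity
  obtain ⟨ν, hν, hνν₀, hν1, hνF, hνE, hνΛ⟩ := exists_small_viscosity (A := A)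
    (E := (Torus.eGradNormSq (∑ mm, Torus.realTrigPoly {(![P t, P t + q] : Fin 2 → (Fin 3 → ℤ)) mm}
      (fun _ => (![zA, zB] : Fin 2 → EuclideanSpace ℂ (Fin 3)) mm))).toReal)
    (L := ∫ x, ⟪(∑ mm, Torus.realTrigPoly {(![P t, P t + q] : Fin 2 → (Fin 3 → ℤ)) mm}
      (fun _ => (![zA, zB] : Fin 2 → EuclideanSpace ℂ (Fin 3)) mm)) x, Torus.laplacian (Φ.grad (u t)) x⟫_ℝ)
    hν₀ hF2 ENNReal.toReal_nonneg hθ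
  -- the Leray ball
  have hball : ‖u t‖ ^ 2 ≤ 16 * (∫ x, ‖f x‖ ^ 2) / ν ^ 2 := by
    rw [le_div_iff₀ (by positivity)]
    have h1 : A ^ 2 * ν ^ 2 ≤ ∫ x, ‖f x‖ ^ 2 := by
      have : ν * (A ^ 2 + 1) ≤ ∫ x, ‖f x‖ ^ 2 := by rwa [le_div_iff₀ (by positivity)] at hνF
      nlinarith [sq_nonneg A, hν.le]
    nlinarith
  -- the FLOOR at `u t`, written on the representative
  have hfl := hcert ν hν hνν₀ (u t) hfin hball
  rw [nsGeneratorPairing_of_ae huU, pairing_of_ae huU, eGradNormSq_congr_ae' huU,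
    inertial_two hGs (P t) q zA zB (hPzA t) (hPqzB t) (hPzB t) hqzB] at hfl
  -- name the surviving scalars and conclude by linear arithmetic
  generalize (Torus.eGradNormSq (∑ mm, Torus.realTrigPoly {(![P t, P t + q] : Fin 2 → (Fin 3 → ℤ)) mm}
      (fun _ => (![zA, zB] : Fin 2 → EuclideanSpace ℂ (Fin 3)) mm))).toReal = E at hfl hνE
  generalize (∫ x, ⟪(∑ mm, Torus.realTrigPoly {(![P t, P t + q] : Fin 2 → (Fin 3 → ℤ)) mm}
      (fun _ => (![zA, zB] : Fin 2 → EuclideanSpace ℂ (Fin 3)) mm)) x, Torus.laplacian (Φ.grad (u t)) x⟫_ℝ) = Λ at hfl hνΛ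
  generalize (∫ x, ⟪(∑ mm, Torus.realTrigPoly {(![P t, P t + q] : Fin 2 → (Fin 3 → ℤ)) mm}
      (fun _ => (![zA, zB] : Fin 2 → EuclideanSpace ℂ (Fin 3)) mm)) x, f x⟫_ℝ) = Pf at hfl ht
  generalize (∫ x, ⟪f x, Φ.grad (u t) x⟫_ℝ) = FG at hfl ht
  generalize (Real.pi * ((((fun j => ((q) j : ℂ)) ⬝ᵥ (WithLp.ofLp (zA)))) *
      ⟪mFourierCoeff (EuclideanSpace.complexify ∘ Φ.grad (u t)) (P t + (P t + q)), zB⟫_ℂ).im) = T₁ at hfl ht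
  generalize (Real.pi * (conj (((fun j => ((q) j : ℂ)) ⬝ᵥ (WithLp.ofLp (zA)))) *
      ⟪mFourierCoeff (EuclideanSpace.complexify ∘ Φ.grad (u t)) q, zB⟫_ℂ).im) = T₂ at hfl ht
  have hv2 : ν * Λ ≤ 1 / 4 := (mul_le_mul_of_nonneg_left (le_abs_self Λ) hν.le).trans hνΛ
  nlinarith [hfl, ht, hνE, hv2, hε₀, hθ, hν]

end Summit.AnomalousDissipation.AnomalousDissipation.Theorems.FloorCertificate.Negative
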